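import Summits.BirchSwinnertonDyer.Rank1Residual.Additive.RamifiedTwistKodairaSymbol
import Summits.BirchSwinnertonDyer.Rank1Residual.Additive.IstarZeroTwistGood
import Summits.BirchSwinnertonDyer.Rank1Residual.Additive.GordIsogenyInvariance
import Summits.BirchSwinnertonDyer.Rank1Residual.X2.IsogenyQuotientLine
import Summits.BirchSwinnertonDyer.Rank1Residual.O5.FlexNFCaseSKodairaLawThreeProofs
import Literature.NumberTheory.EllipticCurves.ManinConstantQuadraticTwistIstarProofs
import Literature.NumberTheory.EllipticCurves.IsogenyQuadraticTwistProofs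
import Literature.NumberTheory.EllipticCurves.QuadraticTwistPadicReduction
import Literature.NumberTheory.DiophantineGeometry.TateAlgorithmRingEquivProofs
import HarnessLib

/-!
# Route `AdditiveKolyvaginRoad`, Manin children of `ManinGoodOddFrameAdditive`: Kodaira type `Iₙ*`
# at an odd prime is a `ℚ`-ISOGENY INVARIANT (no irreducibility, no Dokchitser–Dokchitser)
# (route-independent; `--supports` stmt-BirchSwinnertonDyer-20094 `ManinFrameResidueClass`)

Cell `pub/bsd-wall` (D-0120, W-ALL lane 3, row 2), seat `bsd-wall-akr-p2` (prover). THEOREMS ONLY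
(no definition, no named fact, no `sorry`); nothing is booked. NO route file is imported.

WHAT THIS FILE DOES. Items 20093 `ManinFrameIstarClass` (closed) and 20094 `ManinFrameResidueClass`
(the open residue) of the route quantify "Kodaira type `Iₙ*` at the place of `ℤ` under `p`" over the
WHOLE `ℚ`-isogeny class of `W` (planner rev 5: "under Irr, `Iₙ*` is class-invariant by
Dokchitser–Dokchitser 2015, print only"). For the UNION over `n ≥ 0` of the types `Iₙ*` no such input
is needed: at an odd prime `p`, "type `Iₙ*` for some `n`" says exactly "additive at `p` and the
`p*`-twist is semistable at `p`", and both halves move along `ℚ`-isogenies. Precisely, with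
`p* = (−1)^{(p−1)/2} p` and `v` the place over `p`:

* `isSemistableAtPrime_quadraticTwist_pStar_of_kodairaSymbolAt_eq_Istar` — **type `Iₙ*` at `v` ⟹
  `E^{(p*)}` is good (`n = 0`) or multiplicative (`n ≥ 1`) at `p`**: the tree theorems
  `Additive.hasGoodReductionAt_quadraticTwist_of_kodairaSymbolAt_eq_Istar_zero` (Tate's algorithm
  Step 6 read backwards, Silverman *ATAEC* IV.9.4 / Ex. 4.49) and
  `hasMultiplicativeReductionAt_quadraticTwist_pStar_of_kodairaSymbolAt_eq_Istar_succ` (*ATAEC*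
  IV.11.1 table p. 368, column `I_ν*`), moved to the prime-indexed predicates.
* `exists_kodairaSymbolAt_ringOfIntegers_eq_Istar_of_isIsogenous`,
  `exists_kodairaSymbolAt_eq_Istar_of_isIsogenous` — **for `E ∼ E'` over `ℚ` and an odd `p`: if
  `E` has type `Iₙ*` at `p` then `E'` has type `Iₘ*` at `p` for some `m`** (at the place of `𝓞 ℚ`,
  resp. of `ℤ`, under `p` — the two symbols agree,
  `O5.FlexNormalForm.kodairaSymbolAt_eq_of_primesEquiv_eq'`; ANY equations of `E`, `E'`). Proof:
  `E^{(p*)} ∼ E'^{(p*)}` (twisting commutes with isogenies, `IsIsogenous.quadraticTwist`, Cremona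
  §3.9), good / multiplicative reduction at `p` is a `ℚ`-isogeny invariant
  (`Additive.hasGoodReductionAtPrime_iff_of_isIsogenous`,
  `X2.IsogenyQuotientLine.hasMultiplicativeReductionAtPrime_of_isIsogenous`; Silverman *AEC*
  VII.7.2), so a global minimal model `V` of `E'^{(p*)}` is semistable at `p`; and
  `E' ≅ (E'^{(p*)})^{(p*)} = C • V^{(p*)}` (`exists_variableChange_smul_eq_quadraticTwist_sq`,
  `quadraticTwist_smul`) is a twist of a `p`-semistable curve by a parameter exactly divisible by
  `p`, hence of type `Iₘ*` (`Additive.kodairaSymbolAt_twist_of_semistable`, Tate's algorithm Steps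
  6–7; Comalada 1994 §2).
* `istarClass_of_kodairaSymbolAt_eq_Istar` — the class hypothesis of `ManinFrameIstarClass`
  (stmt-BirchSwinnertonDyer-20093) in its filed shape, from the type of ONE member; dually the
  `Iₙ*`-conjunct of the residue `ManinFrameResidueClass` (stmt-BirchSwinnertonDyer-20094) may be
  read on any member (`forall_kodairaSymbolAt_ne_Istar_of_isIsogenous`).

What does NOT transport without Dokchitser–Dokchitser: the index `n` itself, and the potentially
good types II/III/IV vs II*/III*/IV* (`GordIsogenyInvarianceClasses.lean`: `v ↦ 12 − v`).

References: [SilvermanATAEC1994] IV.9.4 Steps 6–7, Table 4.1, IV.11.1 table p. 368, Ex. 4.49;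
[SilvermanAEC2009] VII.5.1, VII.7.2, X.5 Cor. 5.4; [CremonaAlgorithms1997] §3.9; S. Comalada,
J. Number Theory 49 (1994) §2.
-/

set_option autoImplicit false
-- the Theorems directory repeats the summit name (sibling precedent `SignedBaseChangeAssembly.lean`)
set_option linter.dupNamespace false

noncomputable section

open scoped Classical NumberField

open WeierstrassCurve NumberField IsDedekindDomain IsDedekindDomain.HeightOneSpectrum
  Rat.HeightOneSpectrum Literature.NumberTheory.DiophantineGeometry
  Literature.NumberTheory.EllipticCurves Literature.NumberTheory.EllipticCurves.ModularForms
  Summit.BirchSwinnertonDyer.Rank1Residual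

namespace Summit.BirchSwinnertonDyer.BirchSwinnertonDyer.Theorems.IstarIsogenyInvariance

/-! ### §1 Type `Iₙ*` at an odd `p` ⟹ the `p*`-twist is semistable at `p` -/

section Place

variable (v : HeightOneSpectrum (𝓞 ℚ))

/-- `p* = (−1)^{⌊p/2⌋} p` is exactly divisible by `p`: `p ∣ p*`, `p² ∤ p*`, `p* ≠ 0`. [folklore] -/
theorem pStar_dvd_facts {p : ℕ} (hp : p.Prime) :
    ((-1 : ℤ) ^ (p / 2) * p ≠ 0) ∧ ((p : ℤ) ∣ (-1 : ℤ) ^ (p / 2) * p) ∧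
      ¬ (p : ℤ) ^ 2 ∣ (-1 : ℤ) ^ (p / 2) * p := by
  have hp0 : (p : ℤ) ≠ 0 := by exact_mod_cast hp.ne_zero
  have hu : IsUnit ((-1 : ℤ) ^ (p / 2)) := isUnit_neg_one.pow _
  refine ⟨mul_ne_zero hu.ne_zero hp0, Dvd.intro_left _ rfl, fun h ↦ ?_⟩
  have h' : (p : ℤ) * p ∣ (p : ℤ) * (-1 : ℤ) ^ (p / 2) := by
    rwa [sq, mul_comm ((-1 : ℤ) ^ (p / 2)) (p : ℤ)] at h
  have h'' : (p : ℤ) ∣ (-1 : ℤ) ^ (p / 2) := (mul_dvd_mul_iff_left hp0).mp h'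
  have h1 : (p : ℤ) ∣ 1 := h''.trans (isUnit_iff_dvd_one.mp hu)
  have hle : (p : ℤ) ≤ 1 := Int.le_of_dvd one_pos h1
  have hlt : (1 : ℤ) < p := by exact_mod_cast hp.one_lt
  omega

/-- **Type `Iₙ*` at the place `v` over an odd prime `p` ⟹ the twist `E^{(p*)}` is good (`n = 0`) or
multiplicative (`n ≥ 1`) at `p`** (prime-indexed predicates). `n = 0`: Tate's algorithm Step 6 read
backwards (`Additive.hasGoodReductionAt_quadraticTwist_of_kodairaSymbolAt_eq_Istar_zero`); `n ≥ 1`: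
`ord_p j < 0` and the ramified quadratic characters of `ℚ_pˣ` agree on `ℤ_pˣ`
(`hasMultiplicativeReductionAt_quadraticTwist_pStar_of_kodairaSymbolAt_eq_Istar_succ`), both moved
to `HasGoodReductionAtPrime` / `HasMultiplicativeReductionAtPrime` by the tree's bridges.
[cite: SilvermanATAEC1994, IV.9.4 Step 6 and IV.11.1 table p. 368] -/
theorem isSemistableAtPrime_quadraticTwist_pStar_of_kodairaSymbolAt_eq_Istar
    (W : WeierstrassCurve ℚ) [W.IsElliptic] (hv2 : (primesEquiv v : ℕ) ≠ 2) {n : ℕ}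
    (hK : W.kodairaSymbolAt v = .Istar n) :
    haveI := Fact.mk (primesEquiv v).2
    (W.quadraticTwist
        ((((-1 : ℤ) ^ ((primesEquiv v : ℕ) / 2) * (primesEquiv v : ℕ) : ℤ)) : ℚ)).HasGoodReductionAtPrime
        (primesEquiv v : ℕ) ∨
      (W.quadraticTwist
        ((((-1 : ℤ) ^ ((primesEquiv v : ℕ) / 2) * (primesEquiv v : ℕ) : ℤ)) : ℚ)).HasMultiplicativeReductionAtPrime
        (primesEquiv v : ℕ) := by
  haveI := Fact.mk (primesEquiv v).2
  have hp : (primesEquiv v : ℕ).Prime := (primesEquiv v).2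
  obtain ⟨hd0, h1, h2⟩ := pStar_dvd_facts hp
  have hd0Q : ((((-1 : ℤ) ^ ((primesEquiv v : ℕ) / 2) * (primesEquiv v : ℕ) : ℤ)) : ℚ) ≠ 0 := by
    exact_mod_cast hd0
  set d : ℤ := (-1 : ℤ) ^ ((primesEquiv v : ℕ) / 2) * (primesEquiv v : ℕ) with hd
  haveI := W.isElliptic_quadraticTwist hd0Q
  cases n with
  | zero =>
    left
    have hgood := Additive.hasGoodReductionAt_quadraticTwist_of_kodairaSymbolAt_eq_Istar_zero v W
      hv2 h1 h2 hK
    exact (hasGoodReductionAtPrime_iff_hasGoodReductionAt_ringOfIntegers v (W.quadraticTwist (d : ℚ))).mpr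
      hgood
  | succ k =>
    right
    -- read the symbol at the place of `ℤ` under `p`
    have hvZ : primesEquiv ((primesEquiv (R := ℤ)).symm ⟨(primesEquiv v : ℕ), hp⟩) = primesEquiv v :=
      (primesEquiv (R := ℤ)).apply_symm_apply _
    have hKZ : W.kodairaSymbolAt ((primesEquiv (R := ℤ)).symm ⟨(primesEquiv v : ℕ), hp⟩) =
        .Istar (k + 1) := by
      rw [O5.FlexNormalForm.kodairaSymbolAt_eq_of_primesEquiv_eq' W
        ((primesEquiv (R := ℤ)).symm ⟨(primesEquiv v : ℕ), hp⟩) v hvZ]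
      exact hK
    have hmult :=
      hasMultiplicativeReductionAt_quadraticTwist_pStar_of_kodairaSymbolAt_eq_Istar_succ hp hv2 hKZ
    exact ((W.quadraticTwist (d : ℚ)).hasMultiplicativeReductionAtPrime_iff_hasMultiplicativeReductionAt_holds
      (primesEquiv v)).mpr hmult

/-! ### §2 Type `Iₙ*` at an odd `p` is a `ℚ`-isogeny invariant -/

/-- **Kodaira type `Iₙ*` (some `n`) at an odd prime is a `ℚ`-isogeny invariant** (place of `𝓞 ℚ`).
For `E ∼ E'` over `ℚ` (any equations `W`, `W'`), `v` the place over an odd prime `p`, and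
`W.kodairaSymbolAt v = Iₙ*`: `W'.kodairaSymbolAt v = Iₘ*` for some `m`. Proof: `E^{(p*)} ∼ E'^{(p*)}`
(`IsIsogenous.quadraticTwist`); `E^{(p*)}` is semistable at `p` (§1), hence so is `E'^{(p*)}`
(`Additive.hasGoodReductionAtPrime_iff_of_isIsogenous`,
`X2.IsogenyQuotientLine.hasMultiplicativeReductionAtPrime_of_isIsogenous`) and its global minimal
model `V` (`hasGlobalMinimalModel_rat_holds`; reduction types are model
invariants, `hasGoodReductionAt_smul_iff_holds`, `hasMultiplicativeReductionAt_smul_iff_holds`);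
`W' = C • V^{(p*)}` (`exists_variableChange_smul_eq_quadraticTwist_sq`, `quadraticTwist_quadraticTwist`,
`quadraticTwist_smul`), so Tate's algorithm returns `Iₘ*` on `W'`
(`Additive.kodairaSymbolAt_twist_of_semistable`).
[cite: SilvermanATAEC1994, IV.9.4 Steps 6–7 (PDF pp. 345–346)]
[cite: SilvermanAEC2009, Cor. VII.7.2 and X.5 Cor. 5.4] [cite: CremonaAlgorithms1997, §3.9 (p. 87)] -/
theorem exists_kodairaSymbolAt_ringOfIntegers_eq_Istar_of_isIsogenous
    {W W' : WeierstrassCurve ℚ} [W.IsElliptic] [W'.IsElliptic] (h : IsIsogenous W W')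
    (hv2 : (primesEquiv v : ℕ) ≠ 2) {n : ℕ} (hK : W.kodairaSymbolAt v = .Istar n) :
    ∃ m : ℕ, W'.kodairaSymbolAt v = .Istar m := by
  haveI := Fact.mk (primesEquiv v).2
  have hp : (primesEquiv v : ℕ).Prime := (primesEquiv v).2
  obtain ⟨hd0, h1, h2⟩ := pStar_dvd_facts hp
  set d : ℤ := (-1 : ℤ) ^ ((primesEquiv v : ℕ) / 2) * (primesEquiv v : ℕ) with hd
  have hd0Q : (d : ℚ) ≠ 0 := by exact_mod_cast hd0
  haveI hX : (W.quadraticTwist (d : ℚ)).IsElliptic := W.isElliptic_quadraticTwist hd0Q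
  haveI hX' : (W'.quadraticTwist (d : ℚ)).IsElliptic := W'.isElliptic_quadraticTwist hd0Q
  -- `E^{(p*)} ∼ E'^{(p*)}`
  have hisoT : IsIsogenous (W.quadraticTwist (d : ℚ)) (W'.quadraticTwist (d : ℚ)) :=
    h.quadraticTwist hd0Q
  -- a global minimal model `V = C₁ • E'^{(p*)}`
  obtain ⟨C₁, hC₁⟩ := hasGlobalMinimalModel_rat_holds (W'.quadraticTwist (d : ℚ))
  haveI := hC₁
  -- `V` is semistable at `v`
  have hV : (C₁ • W'.quadraticTwist (d : ℚ)).HasGoodReductionAt v ∨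
      (C₁ • W'.quadraticTwist (d : ℚ)).HasMultiplicativeReductionAt v := by
    rcases isSemistableAtPrime_quadraticTwist_pStar_of_kodairaSymbolAt_eq_Istar v W hv2 hK with
      hg | hm
    · left
      have hg' := (Additive.hasGoodReductionAtPrime_iff_of_isIsogenous hisoT (primesEquiv v : ℕ)).mp hg
      have hg'' := (hasGoodReductionAtPrime_iff_hasGoodReductionAt_ringOfIntegers v _).mp hg'
      exact (hasGoodReductionAt_smul_iff_holds v (W'.quadraticTwist (d : ℚ)) C₁).mpr hg''
    · right
      have hm' := X2.IsogenyQuotientLine.hasMultiplicativeReductionAtPrime_of_isIsogenous hisoT hm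
      have hm'' := ((W'.quadraticTwist (d : ℚ))
        |>.hasMultiplicativeReductionAtPrime_iff_hasMultiplicativeReductionAt_ringOfIntegers v).mp hm'
      exact (hasMultiplicativeReductionAt_smul_iff_holds v (W'.quadraticTwist (d : ℚ)) C₁).mpr hm''
  -- `W' = C • V^{(p*)}`: twisting twice by `p*` is an isomorphism
  obtain ⟨C₂, hC₂⟩ := W'.exists_variableChange_smul_eq_quadraticTwist_sq hd0Q
  have hVt : (C₁ • W'.quadraticTwist (d : ℚ)).quadraticTwist (d : ℚ) =
      ((⟨C₁.u, (d : ℚ) * C₁.r, 0, 0⟩ : VariableChange ℚ) * C₂) • W' := by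
    rw [quadraticTwist_smul, quadraticTwist_quadraticTwist, ← sq, ← hC₂, mul_smul]
  have hW : ((⟨C₁.u, (d : ℚ) * C₁.r, 0, 0⟩ : VariableChange ℚ) * C₂)⁻¹ •
      (C₁ • W'.quadraticTwist (d : ℚ)).quadraticTwist (d : ℚ) = W' := by
    rw [hVt, inv_smul_smul]
  exact Additive.kodairaSymbolAt_twist_of_semistable v (C₁ • W'.quadraticTwist (d : ℚ)) hv2 hd0 h1 h2
    hV _ hW

end Place

/-- **Kodaira type `Iₙ*` (some `n`) at an odd prime is a `ℚ`-isogeny invariant** (place of `ℤ` with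
generator `p`, the vocabulary of the route's items): for `E ∼ E'` over `ℚ` (any equations), `p` odd,
`v` a place of `ℤ` with `natGenerator v = p` and `W.kodairaSymbolAt v = Iₙ*`:
`W'.kodairaSymbolAt v = Iₘ*` for some `m`.
[cite: SilvermanATAEC1994, IV.9.4 Steps 6–7 (PDF pp. 345–346)]
[cite: SilvermanAEC2009, Cor. VII.7.2] [cite: CremonaAlgorithms1997, §3.9 (p. 87)] -/
theorem exists_kodairaSymbolAt_eq_Istar_of_isIsogenous
    {W W' : WeierstrassCurve ℚ} [W.IsElliptic] [W'.IsElliptic] (h : IsIsogenous W W')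
    {p : ℕ} (hp2 : p ≠ 2) (v : HeightOneSpectrum ℤ) (hv : natGenerator v = p)
    {n : ℕ} (hK : W.kodairaSymbolAt v = .Istar n) : ∃ m : ℕ, W'.kodairaSymbolAt v = .Istar m := by
  set v' : HeightOneSpectrum (𝓞 ℚ) := (primesEquiv (R := 𝓞 ℚ)).symm (primesEquiv v) with hv'
  have hvv' : primesEquiv v = primesEquiv v' := ((primesEquiv (R := 𝓞 ℚ)).apply_symm_apply _).symm
  have hv2 : (primesEquiv v' : ℕ) ≠ 2 := by
    rw [← hvv']
    change natGenerator v ≠ 2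
    rw [hv]
    exact hp2
  rw [O5.FlexNormalForm.kodairaSymbolAt_eq_of_primesEquiv_eq' W v v' hvv'] at hK
  obtain ⟨m, hm⟩ := exists_kodairaSymbolAt_ringOfIntegers_eq_Istar_of_isIsogenous v' h hv2 hK
  exact ⟨m, by rw [O5.FlexNormalForm.kodairaSymbolAt_eq_of_primesEquiv_eq' W' v v' hvv', hm]⟩

/-! ### §3 The class hypotheses of the route's Manin children, read on one member -/

/-- **The class hypothesis of `ManinFrameIstarClass` (stmt-BirchSwinnertonDyer-20093) from ONE
member**: if `W` has type `Iₙ*` at a place `v` of `ℤ` with generator the odd prime `p`, then every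
`W' ∼ W` has type `Iₘ*` at a place with generator `p` (namely `v`).
[cite: SilvermanATAEC1994, IV.9.4 Steps 6–7] -/
theorem istarClass_of_kodairaSymbolAt_eq_Istar {W : WeierstrassCurve ℚ} [W.IsElliptic] {p : ℕ}
    (hp2 : p ≠ 2) (v : HeightOneSpectrum ℤ) (hv : natGenerator v = p) {n : ℕ}
    (hK : W.kodairaSymbolAt v = .Istar n) :
    ∀ (W' : WeierstrassCurve ℚ) [W'.IsElliptic] [W'.IsGloballyMinimal], IsIsogenous W W' →
      ∃ (v : HeightOneSpectrum ℤ) (n : ℕ), natGenerator v = p ∧ W'.kodairaSymbolAt v = .Istar n :=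
  fun W' _ _ hiso ↦ by
    obtain ⟨m, hm⟩ := exists_kodairaSymbolAt_eq_Istar_of_isIsogenous hiso hp2 v hv hK
    exact ⟨v, m, hv, hm⟩

/-- **The `Iₙ*`-conjunct of the residue `ManinFrameResidueClass` (stmt-BirchSwinnertonDyer-20094) from
ONE member**: if some place `v` of `ℤ` with generator the odd prime `p` has `W.kodairaSymbolAt v ≠ Iₙ*`
for every `n`, then the same holds for every `W' ∼ W` at every place with generator `p` (there is
only one, and the type would transport back to `W`). [cite: SilvermanATAEC1994, IV.9.4 Steps 6–7] -/
theorem forall_kodairaSymbolAt_ne_Istar_of_isIsogenous {W W' : WeierstrassCurve ℚ} [W.IsElliptic]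
    [W'.IsElliptic] (h : IsIsogenous W W') {p : ℕ} (hp2 : p ≠ 2)
    (v : HeightOneSpectrum ℤ) (hv : natGenerator v = p)
    (hK : ∀ n : ℕ, W.kodairaSymbolAt v ≠ .Istar n) :
    ∀ (v' : HeightOneSpectrum ℤ) (n : ℕ), natGenerator v' = p →
      W'.kodairaSymbolAt v' ≠ .Istar n := by
  intro v' n hv' hK'
  have hvv : v' = v := by
    apply (primesEquiv (R := ℤ)).injective
    exact Subtype.ext (hv'.trans hv.symm)
  subst hvv
  obtain ⟨m, hm⟩ := exists_kodairaSymbolAt_eq_Istar_of_isIsogenous h.symm_of_charZero hp2 v' hv' hK'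
  exact hK m hm

end Summit.BirchSwinnertonDyer.BirchSwinnertonDyer.Theorems.IstarIsogenyInvariance

end
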